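import Literature.NumberTheory.LFunctions.ZetaZeroMultiplicityRHGoldstonGonek
import Literature.NumberTheory.LFunctions.ZetaArgRHExplicitCor1Proofs
import Mathlib.Analysis.Real.Pi.Bounds
import Mathlib.Analysis.Complex.ExponentialBounds
import HarnessLib

/-!
# RH-CONDITIONAL — Explicit zeros-in-a-window and multiplicity bounds under RH from Simonič's `|S(t)| ≤ 0.96 log t/log log t`: `m(ρ) ≤ 2 log γ/log log γ` for `γ ≥ 31` («nothing here bears on the truth of RH»)

Topic `Literature/NumberTheory/LFunctions` (RH literature-typing tranche 1, L4 "explicit zero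
statistics"; RH-conditional companion of the RH-free `ZetaZeroWindowsExplicit.lean`).  Label:
**RH-CONDITIONAL** — everything here is a THEOREM; RH and Simonič's Corollary 1
(`Literature.NumberTheory.LFunctions.Simonic2022_cor1_S`: on RH, `|S(t)| ≤ 0.96 log t/log log t`
for `t ≥ 2π`; a named fact of `ZetaArgRHExplicit.lean`, itself a proved consequence of Simonič's
Theorem 1 and two Brent–Platt–Trudgian facts, `Simonic2022_cor1_S_of_thm1_S`) enter as explicit
hypotheses.  No named fact and no definition is introduced.  Nothing is asserted about RH; nothing
here bears on the truth of RH.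

* `Literature.NumberTheory.LFunctions.Simonic2022_cor1_S.window_le` — on RH, for `t ≥ 21` and
  `h ≥ 0`: **`N(t+h) − N(t) ≤ (h/2π) log((t+h)/2π) + 1.92 log(t+h)/log log(t+h) + 0.04`**
  (the RH-free window inequality `Literature.NumberTheory.LFunctions.ZetaZeroWindows.count_diff_le`
  with Simonič's bound at `t` and `t + h`, and `log t/log log t` non-decreasing on `[e^e, ∞)`).
* `Literature.NumberTheory.LFunctions.Simonic2022_cor1_S.multiplicity_le` — on RH, **every zero `ρ`
  of `ζ` with `Im ρ ≥ 31` has multiplicity `m(ρ) ≤ 2 log(Im ρ)/log log(Im ρ)`**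
  (`Literature.NumberTheory.LFunctions.multiplicity_of_S_bound` with `c = 0.96`, `δ = 0.08`).
* `Literature.NumberTheory.LFunctions.Simonic2022_thm1_S.multiplicity_le` — the same from Simonič's
  Theorem 1 and the Brent–Platt–Trudgian facts (via `Simonic2022_cor1_S_of_thm1_S`).

(For comparison, unconditionally `m(ρ) ≤ 0.6166 log γ + 6.506`,
`Literature.NumberTheory.LFunctions.riemannZetaZeroOrder_le_explicit`; asymptotically on RH
`m(ρ) ≤ (½ + o(1)) log γ/log log γ`, `Literature.NumberTheory.LFunctions.GoldstonGonek2007_cor1_multiplicity`.)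

## References

* A. Simonič, J. Number Theory 231 (2022) 464–491, Cor. 1 (arXiv:2010.13307v2). [Simonic2022]
* D. A. Goldston, S. M. Gonek, Bull. Lond. Math. Soc. 39 (2007) 482–486, Cor. 1. [GoldstonGonek2007]
* E. C. Titchmarsh, *The Theory of the Riemann Zeta-Function*, 2nd ed., §9.2. [Titchmarsh1986]
-/

noncomputable section

open Real

namespace Literature.NumberTheory.LFunctions

open SchoenfeldBound

namespace Simonic2022_cor1_S

/-- `t ↦ log t/log log t` is non-decreasing on `[e^e, ∞)`. [cite: Simonic2022, Cor. 1] -/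
private theorem log_div_loglog_mono {t t' : ℝ} (ht : Real.exp (Real.exp 1) ≤ t) (htt' : t ≤ t') :
    Real.log t / Real.log (Real.log t) ≤ Real.log t' / Real.log (Real.log t') := by
  have ht0 : 0 < t := lt_of_lt_of_le (Real.exp_pos _) ht
  have hx : Real.exp 1 ≤ Real.log t := by rw [Real.le_log_iff_exp_le ht0]; exact ht
  have hxx' : Real.log t ≤ Real.log t' := Real.log_le_log ht0 htt'
  have hx' : Real.exp 1 ≤ Real.log t' := hx.trans hxx'
  have he := Real.exp_one_gt_d9
  have hl0' : 0 < Real.log t' := by linarith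
  have hll' : 0 < Real.log (Real.log t') := Real.log_pos (by linarith)
  have h := Real.log_div_self_antitoneOn hx hx' hxx'
  rw [← inv_div (Real.log (Real.log t)), ← inv_div (Real.log (Real.log t'))]
  exact inv_anti₀ (div_pos hll' hl0') h

/-- `e^e ≤ 21`. [cite: Simonic2022, Cor. 1] -/
private theorem exp_exp_one_le : Real.exp (Real.exp 1) ≤ 21 := by
  have he := Real.exp_one_lt_d9
  have he0 := Real.exp_pos 1
  calc Real.exp (Real.exp 1) ≤ Real.exp 3 := Real.exp_le_exp.2 (by linarith)
    _ = Real.exp 1 ^ 3 := by rw [Real.exp_one_pow]; norm_num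
    _ ≤ 2.7182818286 ^ 3 := by gcongr
    _ ≤ 21 := by norm_num

/-- **Zeros in a window under RH, explicit**: assume RH and Simonič's Corollary 1; then for
`t ≥ 21` and `h ≥ 0`, `N(t+h) − N(t) ≤ (h/2π) log((t+h)/2π) + 1.92 log(t+h)/log log(t+h) + 0.04`.
[cite: Simonic2022, Cor. 1 (S(t))] -/
theorem window_le (hcor : Simonic2022_cor1_S) (hRH : RiemannHypothesis) {t h : ℝ} (ht : 21 ≤ t)
    (hh : 0 ≤ h) :
    (zetaZeroCount (t + h) : ℝ) - zetaZeroCount t ≤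
      h / (2 * π) * Real.log ((t + h) / (2 * π)) +
        1.92 * Real.log (t + h) / Real.log (Real.log (t + h)) + 0.04 := by
  have hπ := Real.pi_gt_d2
  have hπ' := Real.pi_lt_d2
  have hee := exp_exp_one_le
  have hc := ZetaZeroWindows.count_diff_le (T := t) (H := h) (by linarith) hh
  have hS0 := hcor hRH t (by linarith)
  have hS1 := hcor hRH (t + h) (by linarith)
  have hmono : Real.log t / Real.log (Real.log t) ≤
      Real.log (t + h) / Real.log (Real.log (t + h)) :=
    log_div_loglog_mono (by linarith) (by linarith)
  have hrem : 2.4 / (π * t) ≤ 0.04 := by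
    rw [div_le_iff₀ (by positivity)]; nlinarith
  rw [mul_div_assoc] at hS0 hS1 ⊢
  linarith

/-- **Explicit multiplicity bound under RH**: assume RH and Simonič's Corollary 1; then every zero
`ρ` of `ζ` with `Im ρ ≥ 31` has multiplicity `m(ρ) ≤ 2 log(Im ρ)/log log(Im ρ)`
(`m = Literature.riemannZetaZeroOrder`; `2 · 0.96 + 0.08 = 2`, thresholds `2π + 1`, `31`,
`1 + 2/0.08 = 26`). [cite: Simonic2022, Cor. 1 (S(t))] -/
theorem multiplicity_le (hcor : Simonic2022_cor1_S) (hRH : RiemannHypothesis) {ρ : ℂ}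
    (hρ : riemannZeta ρ = 0) (hγ : 31 ≤ ρ.im) :
    (riemannZetaZeroOrder ρ : ℝ) ≤ 2 * Real.log ρ.im / Real.log (Real.log ρ.im) := by
  have hπ' := Real.pi_lt_d2
  have h := multiplicity_of_S_bound (c := 0.96) (δ := 0.08) (t₁ := 2 * π) (by norm_num) (by norm_num)
    (hcor hRH) hρ (by linarith) hγ (by norm_num; linarith)
  norm_num at h
  exact h

end Simonic2022_cor1_S

/-- **Explicit multiplicity bound under RH from Simonič's Theorem 1** (and the Brent–Platt–Trudgian
facts through which Corollary 1 is proved in the tree): `m(ρ) ≤ 2 log(Im ρ)/log log(Im ρ)` for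
every zero with `Im ρ ≥ 31`. [cite: Simonic2022, Thm. 1, Cor. 1] -/
theorem Simonic2022_thm1_S.multiplicity_le (h : Simonic2022_thm1_S) (h₁ : BrentPlattTrudgian2022_cor1)
    (h₂ : BrentPlattTrudgian2022_lemma1) (hRH : RiemannHypothesis) {ρ : ℂ}
    (hρ : riemannZeta ρ = 0) (hγ : 31 ≤ ρ.im) :
    (riemannZetaZeroOrder ρ : ℝ) ≤ 2 * Real.log ρ.im / Real.log (Real.log ρ.im) :=
  (Simonic2022_cor1_S_of_thm1_S h h₁ h₂).multiplicity_le hRH hρ hγ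

end Literature.NumberTheory.LFunctions

end
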